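import Summits.ResolutionOfSingularities.ResolutionOfSingularities.Theorems.UniformComplexityCampaignW82SeparableTightness
import Summits.ResolutionOfSingularities.ResolutionOfSingularities.Theorems.UniformComplexityCampaignW82FamilyResolutionSepGraded
import Summits.ResolutionOfSingularities.ResolutionOfSingularities.Theorems.UniformComplexityCampaignW82FamilyResolutionRungs
import Summits.ResolutionOfSingularities.ResolutionOfSingularities.Theorems.UniformComplexityCampaignW82TwistExponentBaseChange
import Literature.AlgebraicGeometry.Resolution.AlterationsDimension
import Mathlib.Topology.KrullDimension
import HarnessLib

/-!
# [OURS · L1 W8.2] Separable tightness in FIBRE DIMENSION 1: families of curves resolve in families, never with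
# separable base extensions

Cell `res-hironaka` (run/shared/lean/pub/res-hironaka/), LADDER-RESOLUTION rung L (RESCUE), slot W8.2, door 2
(`UniformComplexity`, host item `PrimeModelTransfer` stmt-ResolutionOfSingularities-8933); prover res-L1-s82-pv-2
(gen 7). THESES-FREE module (imports the gen-7 headline `…SeparableTightness` (p563120), the OURS statement file
`…FamilyResolutionSepGraded` (p562026: `CampaignW82.FamilyResolutionSepDimLe`), the gen-5 rungs file
`…FamilyResolutionRungs` (p531789: `familyResolutionDimLe_one`), the gen-3 `…TwistExponentBaseChange`
(`topologicalKrullDim_twistCurve_le_one`), the tree file `Literature.AlgebraicGeometry.Resolution.AlterationsDimension`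
(`topologicalKrullDim_eq_of_isOpenImmersion`, Görtz–Wedhorn 5.22 (3)), Mathlib, `HarnessLib`).

THE RESULT — the grade-1 dichotomy, for every field `k` of characteristic `p > 0`:
* `familyResolutionDimLe_one_and_not_sep : FamilyResolutionDimLe k 1 ∧ ¬ FamilyResolutionSepDimLe k 1` — resolution in
  families HOLDS for families of curves (after an algebraic base extension; p531789, unconditional) and FAILS for
  families of curves when the base extension is required separable (`not_familyResolutionSepDimLe_one`; witness the
  compactified Kollár pencil, whose geometric generic fibre is an integral CURVE:
  `topologicalKrullDim_pullback_le_one_of_pencil_dense`).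
* `not_familyResolutionSepDimLe_of_one_le` — hence `¬ FamilyResolutionSepDimLe k n` in every grade `n ≥ 1`.

HONEST FRAMING. OURS negative-side bookkeeping about OURS campaign statements; NOT a statement of H. Hironaka's 2017
manuscript ([Hironaka2017]); nothing here is attributed to its author. AI work, weaker than expert review.

## References (vocabulary and locators only)
* J. Kollár, *Lectures on Resolution of Singularities* (2007), 1.19. [Kollar2007]
* U. Görtz, T. Wedhorn, *Algebraic Geometry I* (2020), Thm. 5.22 (3). [GortzWedhorn2020]
-/

noncomputable section

set_option linter.dupNamespace false -- mandated namespace of this single-conjunct summit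

open Polynomial
open _root_.CategoryTheory _root_.CategoryTheory.Limits _root_.AlgebraicGeometry _root_.TopologicalSpace
open Literature.AlgebraicGeometry.Resolution

namespace Summit.ResolutionOfSingularities.ResolutionOfSingularities.Theorems.CampaignW82.SeparableTightness

/-! ## The graded form: families of curves -/

section Graded

variable {A : Type} [CommRing A] (p : ℕ) (t : A) (q : ℕ)

/-- **The flat field-valued fibres of a family containing the pencil densely are CURVES** (dimension `≤ 1`):
for `f : 𝒳 → Spec A` locally of finite type containing the Kollár pencil as a quasi-compact scheme-theoretically
dominant open over `A` and a flat `φ₀ : A → L` to a field, `dim (𝒳 ×_A Spec L) ≤ 1`. Indeed `𝒳 ×_A Spec L` is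
integral (`isIntegral_pullback_of_pencil_dense`) and locally of finite type over `L`, so its dimension is that of
any non-empty open subscheme (tree `topologicalKrullDim_eq_of_isOpenImmersion`, Görtz–Wedhorn 5.22 (3)), e.g. of
the base-changed pencil `≅ C_1(L, φ₀ t)`, a plane curve (`TwistExponent.topologicalKrullDim_twistCurve_le_one`).
[cite: GortzWedhorn2020, Thm. 5.22 (3)] -/
theorem topologicalKrullDim_pullback_le_one_of_pencil_dense [Fact p.Prime] [Fact q.Prime] (hqp : q ≠ p)
    {𝒳 : Scheme.{0}} (f : 𝒳 ⟶ Spec (.of A)) [LocallyOfFiniteType f]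
    (j : pencil A p t q ⟶ 𝒳) [IsOpenImmersion j] [QuasiCompact j] [IsSchemeTheoreticallyDominant j]
    (hj : j ≫ f = pencilTo A p t q) {L : Type} [Field L] (φ₀ : A →+* L) (hflat : φ₀.Flat) :
    topologicalKrullDim ↥(pullback f (Spec.map (CommRingCat.ofHom φ₀))) ≤ 1 := by
  set b := pullback.fst f (Spec.map (CommRingCat.ofHom φ₀)) with hb
  haveI : IsIntegral (pullback f (Spec.map (CommRingCat.ofHom φ₀))) :=
    isIntegral_pullback_of_pencil_dense p t q hqp f j hj φ₀ hflat
  have sq₀ : IsPullback b (pullback.snd f (Spec.map (CommRingCat.ofHom φ₀))) f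
      (Spec.map (CommRingCat.ofHom φ₀)) := IsPullback.of_hasPullback _ _
  have sqP : IsPullback (pullback.fst j b) (pullback.snd j b) j b := IsPullback.of_hasPullback j b
  have sqP' : IsPullback (pullback.fst j b) (pullback.snd j b ≫ pullback.snd f (Spec.map (CommRingCat.ofHom φ₀)))
      (pencilTo A p t q) (Spec.map (CommRingCat.ofHom φ₀)) := by
    rw [← hj]; exact sqP.paste_vert sq₀
  -- the base-changed pencil `P ≅ C_1(L, φ₀ t)`: integral, of dimension `≤ 1`
  let eP : pullback j b ≅ TwistExponent.twistCurve L p (φ₀ t) q 1 :=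
    sqP'.isoPullback ≪≫ pullbackPencilIso A p t q φ₀
  have hq1 : ¬ q ∣ 1 := fun h => (Fact.out : q.Prime).ne_one (Nat.dvd_one.mp h)
  haveI : IsDomain (TwistExponent.TwistRing L p (φ₀ t) q 1) :=
    TwistExponent.isDomain_twistRing (K := L) (t := φ₀ t) hqp (N := 1) hq1
  haveI : Nonempty ↥(pullback j b) := ⟨eP.inv (⊥ : PrimeSpectrum _)⟩
  haveI : IsIntegral (pullback j b) := isIntegral_of_isOpenImmersion eP.hom
  have hT : topologicalKrullDim ↥(TwistExponent.twistCurve L p (φ₀ t) q 1) ≤ 1 :=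
    TwistExponent.topologicalKrullDim_twistCurve_le_one (K := L) (P := p) (t := φ₀ t) (q := q)
      (TwistExponent.twistPoly_ne_zero (K := L) (t := φ₀ t) hqp hq1)
  -- `dim (𝒳 ×_A L) = dim P = dim C_1 ≤ 1`
  have h1 : topologicalKrullDim ↥(pullback j b) =
      topologicalKrullDim ↥(pullback f (Spec.map (CommRingCat.ofHom φ₀))) :=
    topologicalKrullDim_eq_of_isOpenImmersion (pullback.snd f (Spec.map (CommRingCat.ofHom φ₀)))
      (pullback.snd j b)
  have h2 : topologicalKrullDim ↥(TwistExponent.twistCurve L p (φ₀ t) q 1) = topologicalKrullDim ↥(pullback j b) :=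
    topologicalKrullDim_eq_of_isOpenImmersion
      (pullback.snd j b ≫ pullback.snd f (Spec.map (CommRingCat.ofHom φ₀))) eP.inv
  rw [← h1, ← h2]
  exact hT

/-- **Graded witness theorem (fibre dimension `1`).** Any finitely generated `k`-domain `A` with `t ∈ A` such that
`X^p − t` is irreducible over `Frac A` witnesses `¬ FamilyResolutionSepDimLe k 1`: the compactified Kollár pencil has
integral geometric generic fibre of dimension `≤ 1` (`topologicalKrullDim_pullback_le_one_of_pencil_dense`), and the
rest is the proof of `not_familyResolutionSep_of_pencilWitness`. [cite: Kollar2007, 1.19] -/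
theorem not_familyResolutionSepDimLe_one_of_pencilWitness {k : Type} [Field k] (p : ℕ) [Fact p.Prime] [CharP k p]
    (A : Type) [CommRing A] [IsDomain A] [Algebra k A] [Algebra.FiniteType k A] (t : A)
    (ht : Irreducible (X ^ p - C (algebraMap A (FractionRing A) t) : (FractionRing A)[X])) :
    ¬ FamilyResolutionSepDimLe k 1 := by
  intro h
  have hp : p.Prime := Fact.out
  haveI : CharP A p := charP_of_injective_algebraMap (algebraMap k A).injective p
  let q := TwistExponent.altPrime p
  haveI : Fact q.Prime := ⟨TwistExponent.altPrime_prime p⟩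
  have hqp : q ≠ p := TwistExponent.altPrime_ne hp
  obtain ⟨𝒳, f, j, hf, hj, hqc, hdom, hjf⟩ := exists_compactifiedPencil A p t q
  haveI := hf
  haveI := hj
  haveI := hqc
  haveI := hdom
  have hΩinj : Function.Injective (algebraMap A (AlgebraicClosure (FractionRing A))) := by
    rw [IsScalarTower.algebraMap_eq A (FractionRing A) (AlgebraicClosure (FractionRing A))]
    exact (algebraMap (FractionRing A) _).injective.comp (IsFractionRing.injective A (FractionRing A))
  have hΩflat := ringHom_flat_of_injective_of_field _ hΩinj
  have hint : IsIntegral (pullback f (Spec.map (CommRingCat.ofHom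
      (algebraMap A (AlgebraicClosure (FractionRing A)))))) :=
    isIntegral_pullback_of_pencil_dense p t q hqp f j hjf _ hΩflat
  have hdim : topologicalKrullDim ↥(pullback f (Spec.map (CommRingCat.ofHom
      (algebraMap A (AlgebraicClosure (FractionRing A)))))) ≤ 1 :=
    topologicalKrullDim_pullback_le_one_of_pencil_dense p t q hqp f j hjf _ hΩflat
  obtain ⟨A', _, _, _, hinj, hft, -, hsep, 𝒴, G, hall⟩ := h A ‹_› 𝒳 f hf hint hdim
  haveI : CharP A' p := charP_of_injective_algebraMap hinj p
  haveI : CharP (FractionRing A') p :=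
    charP_of_injective_algebraMap (IsFractionRing.injective A' (FractionRing A')) p
  have hflat : ((algebraMap A' (FractionRing A')).comp (algebraMap A A')).Flat :=
    ringHom_flat_of_injective_of_field _ ((IsFractionRing.injective A' (FractionRing A')).comp hinj)
  have ht' := irreducible_X_pow_sub_C_of_formallyUnramified p hinj hft hsep t ht
  exact false_of_isWeakResolution_two_fibres p t q hqp f j hjf (algebraMap A' (FractionRing A'))
    (algebraMap (FractionRing A') (AlgebraicClosure (FractionRing A'))) hflat ht' G (hall _ _) (hall _ _)

/-- **SEPARABLE TIGHTNESS IN FIBRE DIMENSION `1`.** For every field `k` of characteristic `p > 0`: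
`¬ FamilyResolutionSepDimLe k 1` — already for families of CURVES, resolution in families with separable base
extensions fails (witness `A = k[t]`, the compactified Kollár pencil). [cite: Kollar2007, 1.19] -/
theorem not_familyResolutionSepDimLe_one (k : Type) [Field k] (p : ℕ) [Fact p.Prime] [CharP k p] :
    ¬ FamilyResolutionSepDimLe k 1 :=
  not_familyResolutionSepDimLe_one_of_pencilWitness p k[X] Polynomial.X (irreducible_X_pow_sub_C_polynomialX k p)

/-- Hence in every grade `n ≥ 1`: `¬ FamilyResolutionSepDimLe k n` (antitonicity). [folklore] -/
theorem not_familyResolutionSepDimLe_of_one_le (k : Type) [Field k] (p : ℕ) [Fact p.Prime] [CharP k p]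
    {n : WithBot ℕ∞} (hn : 1 ≤ n) : ¬ FamilyResolutionSepDimLe k n :=
  fun h => not_familyResolutionSepDimLe_one k p (familyResolutionSepDimLe_anti k hn h)

/-- **THE GRADE-1 DICHOTOMY.** For every field `k` of characteristic `p > 0`: RESOLUTION IN FAMILIES HOLDS FOR
FAMILIES OF CURVES (`familyResolutionDimLe_one`, p531789 — after an algebraic base extension, unconditionally),
AND NEVER WITH SEPARABLE BASE EXTENSIONS (`not_familyResolutionSepDimLe_one`): `FamilyResolutionDimLe k 1 ∧
¬ FamilyResolutionSepDimLe k 1`. The inseparability of the base extension in the family form is load-bearing in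
the lowest non-trivial grade. [cite: Kollar2007, 1.19] -/
theorem familyResolutionDimLe_one_and_not_sep (k : Type) [Field k] (p : ℕ) [Fact p.Prime] [CharP k p] :
    FamilyResolutionDimLe k 1 ∧ ¬ FamilyResolutionSepDimLe k 1 :=
  ⟨familyResolutionDimLe_one k, not_familyResolutionSepDimLe_one k p⟩

end Graded

end Summit.ResolutionOfSingularities.ResolutionOfSingularities.Theorems.CampaignW82.SeparableTightness

end
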